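import Summits.KontsevichZagierPeriods.Zeta5Search.Barrier.ConeGammaCuspSymmetricDefectBound

/-!
# ζ(5) search — BARRIER: THE SPREAD BOUND — a junction's vote is at most the L¹-spread of its member flip times

HONEST FRAMING (cell `pub-zeta5`): systematic search; no irrationality claim unless kernel-certified. MODEL objects
under Brown–Zudilin's (28)+(30) accounting ([BZ22] = arXiv:2210.03391; (28) observed, not proved); nothing here is a
statement about `ζ(5)`, any `γ` of record, the cone's supremum (C2 OPEN) or the SIGN of any vote at a named direction
(DATA of the cell); S-E stays CONJECTURED; records in print UNMOVED. Prover P2 g26, sequel of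
`ConeGammaWallOrientation` / `ConeGammaCuspSymmetricDefectBound` (plan INBOX 2026-08-27, landing line of the item
«wall orientation»).

At a breakpoint `b` of the orbit `u ↦ u·s(a)` the symmetric part of the cusp slope contributes the four-germ sum
`R_b(δ) = germR(δ) + germL(δ) + germR(−δ) + germL(−δ)` = `∫₀^W` of reflection defects (`germ_symm_eq_integral_refl`).
At local time `w` the displacement `η(w·s(a) ± δ)` has member form `k` negative iff `w < ∓r_k`, `r_k = φ_k(δ)/h_k(a)` the
FLIP TIME of member `k`; by `abs_reflDefect_le_card` / `_pos` the defect is at most the number of members on either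
side of `∓w`, hence at most the number of members whose flip time separates `∓w` from ANY fixed real `c`:
* `card_filter_le_sum_indicator` (the counting step), **`abs_refl_integrand_le_indicators`** (pointwise, off a finite
  set of `w`): `|integrand(w)| ≤ Σ_{k∈M} (𝟙_{J_k}(−w) + 𝟙_{J_k}(w))`, `J_k` the open interval between `c` and `r_k`;
* **`abs_germ_symm_le_spread`** — for `b ∈ bkpts a T` (all 28 forms positive), ANY finset `M` containing the members at
  `b`, every displacement `δ`, every admissible scale (`0 < η`, `ηK < 1`, `ηK < wallDist`) and EVERY real `c`:
  `|R_b(δ)| ≤ Σ_{k∈M} |φ_k(δ)/h_k(a) − c|` — the vote of a junction is at most the L¹-SPREAD of its member flip times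
  (best `c`: a median; `c = 0`: P2 g11's no-cancellation mass; two walls, `c` = one flip time: the splitting bound
  `abs_germ_symm_le_splitting_of_two_wall`);
* **`germ_symm_eq_zero_of_common_flip`** — if all members of the junction flip at the SAME local time (`φ_k(δ)/h_k = c`
  for every member), the junction casts NO vote: `R_b(δ) = 0` (generalises `germ_symm_eq_zero_of_single_wall`; the
  kernel form of «the resonances that `δ` preserves drop out»); `abs_germ_symm_le_mass` (`c = 0`).
DESK (DATA, `HOME/pub-zeta5-p2/g26/alg/spread.py`, exact): 0 violations at every multi-wall junction × displacement of
record/41, flag/60, argmax-120, t*/480; per period `Σ_b |R_b| / Σ_b spread ≈ 0.29–0.52`; at t* along the ridge direction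
`w` the spread is `0.889` against a raw mass `5.428`. NOT here (honest): any sign, anything about `γ`, C2, S-E, `ζ(5)`.
-/

noncomputable section

open Set MeasureTheory
open scoped Topology

namespace Summit.KontsevichZagierPeriods.Zeta5Search.Barrier.ConeGamma

/-- **Counting step.** For reals `r_k`, a pivot `c` and a point `x ≠ c`: if `c < x`, the number of `k ∈ M` with
`x < r_k` is at most `Σ_{k∈M} 𝟙[x ∈ (min c r_k, max c r_k)]`; if `x < c`, the same holds for the number of `k ∈ M` with
`r_k < x` (each counted `k` has its interval straddling `x`). -/
theorem card_filter_le_sum_indicator (M : Finset (Fin 28)) (r : Fin 28 → ℝ) (c x : ℝ) :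
    (c < x → ((M.filter fun k => x < r k).card : ℝ) ≤
      ∑ k ∈ M, (Ioo (min c (r k)) (max c (r k))).indicator (fun _ => (1 : ℝ)) x) ∧
    (x < c → ((M.filter fun k => r k < x).card : ℝ) ≤
      ∑ k ∈ M, (Ioo (min c (r k)) (max c (r k))).indicator (fun _ => (1 : ℝ)) x) := by
  have hnn : ∀ k, (0 : ℝ) ≤ (Ioo (min c (r k)) (max c (r k))).indicator (fun _ => (1 : ℝ)) x :=
    fun k => Set.indicator_nonneg (fun _ _ => zero_le_one) _
  constructor
  · intro hcx
    rw [Finset.card_filter]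
    push_cast
    refine Finset.sum_le_sum fun k _ => ?_
    split_ifs with h
    · rw [Set.indicator_of_mem (show x ∈ Ioo (min c (r k)) (max c (r k)) from
        ⟨lt_of_le_of_lt (min_le_left _ _) hcx, lt_of_lt_of_le h (le_max_right _ _)⟩)]
    · exact hnn k
  · intro hxc
    rw [Finset.card_filter]
    push_cast
    refine Finset.sum_le_sum fun k _ => ?_
    split_ifs with h
    · rw [Set.indicator_of_mem (show x ∈ Ioo (min c (r k)) (max c (r k)) from
        ⟨lt_of_le_of_lt (min_le_right _ _) h, lt_of_lt_of_le hxc (le_max_left _ _)⟩)]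
    · exact hnn k

/-- **Pointwise: the reflection-form integrand is at most the number of member flip intervals straddling `∓w`.** At
`b ∈ bkpts a T` (all forms positive), `M ⊇` the members at `b`, scale `0 < η` with `ηK < 1`, `ηK < wallDist`, a pivot
`c`, and a local time `w ∈ (0, W]` with `w ≠ ±c` at which no member form of `w·s ± δ` vanishes:
`|integrand(w)| ≤ Σ_{k∈M} (𝟙_{J_k}(−w) + 𝟙_{J_k}(w))`, `J_k = (min(c, r_k), max(c, r_k))`, `r_k = φ_k(δ)/h_k(a)`
(at `η(w·s+δ)` member `k` is negative iff `r_k < −w`, at `η(w·s−δ)` iff `w < r_k`; then `abs_reflDefect_le_card` /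
`_pos` and the counting step on the side of `c`). -/
theorem abs_refl_integrand_le_indicators {a : Dir} (hpos : ∀ k, 0 < h28 a k) {T b : ℝ} (hb : b ∈ bkpts a T)
    {M : Finset (Fin 28)} (hM : ∀ k, (∃ z : ℤ, b * h28 a k = z) → k ∈ M) (δ : Fin 8 → ℝ)
    {η : ℝ} (hη : 0 < η) (h1 : η * clusterBound a δ < 1) (h2 : η * clusterBound a δ < wallDist a T)
    (c : ℝ) {w : ℝ} (hw0 : 0 < w) (hwW : w ≤ clusterWidth a δ) (hwc : w ≠ c) (hwc' : w ≠ -c)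
    (hflip : ∀ k ∈ M, w * h28 a k + phiForm δ k ≠ 0 ∧ w * h28 a k - phiForm δ k ≠ 0) :
    |(shiftDiff a δ η (b + η * w) + shiftDiff a (-δ) η (b - η * w)) +
        (shiftDiff a (-δ) η (b + η * w) + shiftDiff a δ η (b - η * w))| ≤
      ∑ k ∈ M, ((Ioo (min c (phiForm δ k / h28 a k)) (max c (phiForm δ k / h28 a k))).indicator
          (fun _ => (1 : ℝ)) (-w) +
        (Ioo (min c (phiForm δ k / h28 a k)) (max c (phiForm δ k / h28 a k))).indicator (fun _ => (1 : ℝ)) w) := by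
  -- a line step below the walls: `t = η·W`
  have hW := clusterWidth_pos hpos δ
  have ht : 0 < η * clusterWidth a δ := mul_pos hη hW
  have htx : η * clusterWidth a δ * xMax a ≤ η * clusterBound a δ := by
    rw [mul_assoc]; exact mul_le_mul_of_nonneg_left (clusterWidth_mul_xMax_le_clusterBound a δ) hη.le
  have ht1 : η * clusterWidth a δ * xMax a < 1 := htx.trans_lt h1
  have ht2 : η * clusterWidth a δ * xMax a < wallDist a T := htx.trans_lt h2
  obtain ⟨⟨hDp1, hDp2, hDm1, hDm2⟩, hform, hF⟩ :=
    refl_integrand_eq_defects hpos hb δ hη h1 h2 ht ht1 ht2 hw0 hwW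
  rw [hF, Finset.sum_add_distrib]
  set r : Fin 28 → ℝ := fun k => phiForm δ k / h28 a k with hr
  have hcnt := fun x => card_filter_le_sum_indicator M r c x
  -- member forms of the two displacements and their signs in terms of the flip times
  have sgnP : ∀ k, (phiForm (η • (w • sParam a + δ)) k < 0 ↔ r k < -w) ∧
      (0 < phiForm (η • (w • sParam a + δ)) k ↔ -w < r k) := by
    intro k
    have hk := hpos k
    rw [hform, hr]
    simp only
    rw [div_lt_iff₀ hk, lt_div_iff₀ hk]
    constructor
    · rw [mul_neg_iff]; constructor
      · rintro (⟨-, h⟩ | ⟨h, -⟩)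
        · linarith
        · linarith
      · intro h; exact Or.inl ⟨hη, by linarith⟩
    · rw [mul_pos_iff]; constructor
      · rintro (⟨-, h⟩ | ⟨h, -⟩)
        · linarith
        · linarith
      · intro h; exact Or.inl ⟨hη, by linarith⟩
  have sgnM : ∀ k, (phiForm (η • (w • sParam a + -δ)) k < 0 ↔ w < r k) ∧
      (0 < phiForm (η • (w • sParam a + -δ)) k ↔ r k < w) := by
    intro k
    have hk := hpos k
    rw [hform, hr, phiForm_neg]
    simp only
    rw [lt_div_iff₀ hk, div_lt_iff₀ hk]
    constructor
    · rw [mul_neg_iff]; constructor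
      · rintro (⟨-, h⟩ | ⟨h, -⟩)
        · linarith
        · linarith
      · intro h; exact Or.inl ⟨hη, by linarith⟩
    · rw [mul_pos_iff]; constructor
      · rintro (⟨-, h⟩ | ⟨h, -⟩)
        · linarith
        · linarith
      · intro h; exact Or.inl ⟨hη, by linarith⟩
  have hnzP : ∀ k, (∃ z : ℤ, b * h28 a k = z) → phiForm (η • (w • sParam a + δ)) k ≠ 0 := fun k hk => by
    rw [hform]; exact mul_ne_zero hη.ne' (hflip k (hM k hk)).1
  have hnzM : ∀ k, (∃ z : ℤ, b * h28 a k = z) → phiForm (η • (w • sParam a + -δ)) k ≠ 0 := fun k hk => by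
    rw [hform, phiForm_neg, ← sub_eq_add_neg]; exact mul_ne_zero hη.ne' (hflip k (hM k hk)).2
  -- the defect of `η(w·s + δ)`: compare `−w` with `c`
  have bP : |(torusN (b • sParam a + η • (w • sParam a + δ)) : ℝ) +
      torusN (b • sParam a - η • (w • sParam a + δ)) -
      (torusN (b • sParam a + (η * clusterWidth a δ) • sParam a) +
        torusN (b • sParam a - (η * clusterWidth a δ) • sParam a))| ≤
      ∑ k ∈ M, (Ioo (min c (r k)) (max c (r k))).indicator (fun _ => (1 : ℝ)) (-w) := by
    rcases lt_or_gt_of_ne (show -w ≠ c from fun h => hwc' (by linarith)) with hlt | hgt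
    · -- `−w < c`: the negative members lie in `{k ∈ M : r_k < −w}`
      refine (abs_reflDefect_le_card hpos hb hDp1 hDp2 hnzP ht ht1 ht2
        (S := M.filter fun k => r k < -w) fun k hk hn => ?_).trans ((hcnt (-w)).2 hlt)
      exact Finset.mem_filter.mpr ⟨hM k hk, (sgnP k).1.mp hn⟩
    · -- `c < −w`: the positive members lie in `{k ∈ M : −w < r_k}`
      refine (abs_reflDefect_le_card_pos hpos hb hDp1 hDp2 hnzP ht ht1 ht2
        (S := M.filter fun k => -w < r k) fun k hk hp => ?_).trans ((hcnt (-w)).1 hgt)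
      exact Finset.mem_filter.mpr ⟨hM k hk, (sgnP k).2.mp hp⟩
  -- the defect of `η(w·s − δ)`: compare `w` with `c`
  have bM : |(torusN (b • sParam a + η • (w • sParam a + -δ)) : ℝ) +
      torusN (b • sParam a - η • (w • sParam a + -δ)) -
      (torusN (b • sParam a + (η * clusterWidth a δ) • sParam a) +
        torusN (b • sParam a - (η * clusterWidth a δ) • sParam a))| ≤
      ∑ k ∈ M, (Ioo (min c (r k)) (max c (r k))).indicator (fun _ => (1 : ℝ)) w := by
    rcases lt_or_gt_of_ne hwc with hlt | hgt
    · refine (abs_reflDefect_le_card_pos hpos hb hDm1 hDm2 hnzM ht ht1 ht2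
        (S := M.filter fun k => r k < w) fun k hk hp => ?_).trans ((hcnt w).2 hlt)
      exact Finset.mem_filter.mpr ⟨hM k hk, (sgnM k).2.mp hp⟩
    · refine (abs_reflDefect_le_card hpos hb hDm1 hDm2 hnzM ht ht1 ht2
        (S := M.filter fun k => w < r k) fun k hk hn => ?_).trans ((hcnt w).1 hgt)
      exact Finset.mem_filter.mpr ⟨hM k hk, (sgnM k).1.mp hn⟩
  exact (abs_add_le _ _).trans (add_le_add bP bM)

/-- The integral of the indicator of an open interval over `[−W, W]` is at most its length. -/
theorem intervalIntegral_indicator_Ioo_le {W : ℝ} (hW : 0 ≤ W) (p q : ℝ) :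
    ∫ x in (-W)..W, (Ioo (min p q) (max p q)).indicator (fun _ => (1 : ℝ)) x ≤ |p - q| := by
  rw [intervalIntegral.integral_of_le (by linarith), integral_indicator measurableSet_Ioo,
    Measure.restrict_restrict measurableSet_Ioo, setIntegral_const, smul_eq_mul, mul_one]
  calc volume.real (Ioo (min p q) (max p q) ∩ Ioc (-W) W)
      ≤ volume.real (Ioo (min p q) (max p q)) :=
        measureReal_mono inter_subset_left (by rw [Real.volume_Ioo]; exact ENNReal.ofReal_ne_top)
    _ = |p - q| := by
        rw [measureReal_def, Real.volume_Ioo, ENNReal.toReal_ofReal (sub_nonneg.mpr min_le_max),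
          max_sub_min_eq_abs']

/-- **THE SPREAD BOUND.** Let all 28 forms of `a` be positive, `b ∈ bkpts a T`, `M` any finset containing the member
forms at `b` (`b·h_k(a) ∈ ℤ ⇒ k ∈ M`), `δ` any displacement, `0 < η` with `ηK < 1`, `ηK < wallDist a T`, and `c` ANY
real. Then `|germR(δ) + germL(δ) + germR(−δ) + germL(−δ)| ≤ Σ_{k∈M} |φ_k(δ)/h_k(a) − c|`: the junction's contribution
to `σ(δ) + σ(−δ)` is at most the L¹-spread of its member flip times `φ_k(δ)/h_k` about any pivot (best: a median).
Members that flip together contribute nothing; `c = 0` is the no-cancellation mass. -/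
theorem abs_germ_symm_le_spread {a : Dir} (hpos : ∀ k, 0 < h28 a k) {T b : ℝ} (hb : b ∈ bkpts a T)
    {M : Finset (Fin 28)} (hM : ∀ k, (∃ z : ℤ, b * h28 a k = z) → k ∈ M) (δ : Fin 8 → ℝ)
    {η : ℝ} (hη : 0 < η) (h1 : η * clusterBound a δ < 1) (h2 : η * clusterBound a δ < wallDist a T) (c : ℝ) :
    |germR a δ η b + germL a δ η b + germR a (-δ) η b + germL a (-δ) η b| ≤
      ∑ k ∈ M, |phiForm δ k / h28 a k - c| := by
  rw [germ_symm_eq_integral_refl]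
  have hW := clusterWidth_pos hpos δ
  -- the integrand and its majorant
  set f : ℝ → ℝ := fun w => (shiftDiff a δ η (b + η * w) + shiftDiff a (-δ) η (b - η * w)) +
    (shiftDiff a (-δ) η (b + η * w) + shiftDiff a δ η (b - η * w)) with hf
  set J : Fin 28 → Set ℝ := fun k => Ioo (min c (phiForm δ k / h28 a k)) (max c (phiForm δ k / h28 a k)) with hJ
  set G : Fin 28 → ℝ → ℝ := fun k w => (J k).indicator (fun _ => (1 : ℝ)) (-w) +
    (J k).indicator (fun _ => (1 : ℝ)) w with hG
  -- integrability
  have hfi : IntervalIntegrable f volume 0 (clusterWidth a δ) := by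
    have hA := intervalIntegrable_shiftDiff_affine a δ η b η 0 (clusterWidth a δ)
    have hB := intervalIntegrable_shiftDiff_affine a δ η b (-η) 0 (clusterWidth a δ)
    have hC := intervalIntegrable_shiftDiff_affine a (-δ) η b η 0 (clusterWidth a δ)
    have hD := intervalIntegrable_shiftDiff_affine a (-δ) η b (-η) 0 (clusterWidth a δ)
    simp only [neg_mul, ← sub_eq_add_neg] at hB hD
    exact (hA.add hD).add (hC.add hB)
  have hIi : ∀ (k : Fin 28) (α β : ℝ), IntervalIntegrable (fun w => (J k).indicator (fun _ => (1 : ℝ)) w)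
      volume α β := fun k α β => by
    refine IntervalIntegrable.mono_fun' (g := fun _ => (1 : ℝ)) intervalIntegrable_const
      ((measurable_const.indicator measurableSet_Ioo).aestronglyMeasurable) ?_
    exact Filter.Eventually.of_forall fun x => (norm_indicator_le_norm_self _ _).trans (by simp)
  have hIn : ∀ (k : Fin 28) (α β : ℝ), IntervalIntegrable (fun w => (J k).indicator (fun _ => (1 : ℝ)) (-w))
      volume α β := fun k α β => by
    refine IntervalIntegrable.mono_fun' (g := fun _ => (1 : ℝ)) intervalIntegrable_const
      (((measurable_const.indicator measurableSet_Ioo).comp measurable_neg).aestronglyMeasurable) ?_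
    exact Filter.Eventually.of_forall fun x => (norm_indicator_le_norm_self _ _).trans (by simp)
  have hGi : ∀ k ∈ M, IntervalIntegrable (G k) volume 0 (clusterWidth a δ) := fun k _ =>
    (hIn k _ _).add (hIi k _ _)
  have hgi : IntervalIntegrable (fun w => ∑ k ∈ M, G k w) volume 0 (clusterWidth a δ) := by
    rw [← Finset.sum_fn]; exact IntervalIntegrable.sum M hGi
  -- the a.e. bound `|f| ≤ Σ G` on `[0, W]`
  set B : Set ℝ := {0, c, -c} ∪ ⋃ k : Fin 28, {(-phiForm δ k) / h28 a k, phiForm δ k / h28 a k} with hBdef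
  have hBfin : B.Finite := by
    rw [hBdef]
    exact (((Set.finite_singleton _).insert _).insert _).union
      (Set.finite_iUnion fun k => (Set.finite_singleton _).insert _)
  have hae : ∀ᵐ w ∂volume, w ∉ B := (measure_eq_zero_iff_ae_notMem).mp (hBfin.measure_zero volume)
  have hbound : (fun w => |f w|) ≤ᵐ[volume.restrict (Icc 0 (clusterWidth a δ))] fun w => ∑ k ∈ M, G k w := by
    rw [Filter.EventuallyLE, ae_restrict_iff' measurableSet_Icc]
    filter_upwards [hae] with w hwB hwI
    have hw0 : 0 < w := lt_of_le_of_ne hwI.1 fun h => hwB (by rw [hBdef, ← h]; exact Or.inl (Or.inl rfl))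
    have hwc : w ≠ c := fun h => hwB (by rw [hBdef, h]; exact Or.inl (Or.inr (Or.inl rfl)))
    have hwc' : w ≠ -c := fun h => hwB (by rw [hBdef, h]; exact Or.inl (Or.inr (Or.inr rfl)))
    have hflip : ∀ k ∈ M, w * h28 a k + phiForm δ k ≠ 0 ∧ w * h28 a k - phiForm δ k ≠ 0 := by
      intro k _
      have hk := hpos k
      have nm : ∀ q : ℝ, (q / h28 a k ∈ ({(-phiForm δ k) / h28 a k, phiForm δ k / h28 a k} : Set ℝ)) →
          w ≠ q / h28 a k := fun q hq h =>
        hwB (by rw [hBdef]; exact Or.inr (Set.mem_iUnion.mpr ⟨k, h ▸ hq⟩))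
      exact ⟨fun h => nm (-phiForm δ k) (Or.inl rfl) (by field_simp; linarith),
        fun h => nm (phiForm δ k) (Or.inr rfl) (by field_simp; linarith)⟩
    have h := abs_refl_integrand_le_indicators hpos hb hM δ hη h1 h2 c hw0 hwI.2 hwc hwc' hflip
    simpa only [hf, hG] using h
  -- integrate
  have hmono := intervalIntegral.integral_mono_ae_restrict hW.le hfi.abs hgi hbound
  have habs := intervalIntegral.abs_integral_le_integral_abs (f := f) (μ := volume) hW.le
  refine (habs.trans hmono).trans ?_
  rw [intervalIntegral.integral_finsetSum hGi]
  refine Finset.sum_le_sum fun k _ => ?_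
  -- one member: fold `w ↦ −w` and bound by the length of `J_k`
  rw [hG, intervalIntegral.integral_add (hIn k _ _) (hIi k _ _)]
  have hneg : ∫ w in (0 : ℝ)..clusterWidth a δ, (J k).indicator (fun _ => (1 : ℝ)) (-w) =
      ∫ w in (-clusterWidth a δ)..0, (J k).indicator (fun _ => (1 : ℝ)) w := by
    have h := intervalIntegral.integral_comp_neg (a := 0) (b := clusterWidth a δ)
      (f := fun w => (J k).indicator (fun _ => (1 : ℝ)) w)
    rw [neg_zero] at h
    exact h
  rw [hneg, intervalIntegral.integral_add_adjacent_intervals (hIi k _ _) (hIi k _ _), hJ]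
  exact (intervalIntegral_indicator_Ioo_le hW.le c _).trans (le_of_eq (abs_sub_comm _ _))

/-- **A JUNCTION WHOSE MEMBERS FLIP TOGETHER CASTS NO VOTE.** If every member form at `b` has the same flip time
(`φ_k(δ)/h_k(a) = c` whenever `b·h_k(a) ∈ ℤ`) — the displacement `δ` moves all the walls through `b` at the same local
time — then `germR(δ) + germL(δ) + germR(−δ) + germL(−δ) = 0` at every admissible scale (generalises
`germ_symm_eq_zero_of_single_wall`). -/
theorem germ_symm_eq_zero_of_common_flip {a : Dir} (hpos : ∀ k, 0 < h28 a k) {T b : ℝ} (hb : b ∈ bkpts a T)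
    (δ : Fin 8 → ℝ) {c : ℝ} (hc : ∀ k, (∃ z : ℤ, b * h28 a k = z) → phiForm δ k / h28 a k = c)
    {η : ℝ} (hη : 0 < η) (h1 : η * clusterBound a δ < 1) (h2 : η * clusterBound a δ < wallDist a T) :
    germR a δ η b + germL a δ η b + germR a (-δ) η b + germL a (-δ) η b = 0 := by
  classical
  have h := abs_germ_symm_le_spread hpos hb (M := Finset.univ.filter fun k => phiForm δ k / h28 a k = c)
    (fun k hk => Finset.mem_filter.mpr ⟨Finset.mem_univ _, hc k hk⟩) δ hη h1 h2 c
  have h0 : ∑ k ∈ Finset.univ.filter (fun k => phiForm δ k / h28 a k = c), |phiForm δ k / h28 a k - c| = 0 :=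
    Finset.sum_eq_zero fun k hk => by rw [(Finset.mem_filter.mp hk).2, sub_self, abs_zero]
  rw [h0] at h
  exact abs_eq_zero.mp (le_antisymm h (abs_nonneg _))

/-- **The no-cancellation bound** (`c = 0`): `|R_b(δ)| ≤ Σ_{k∈M} |φ_k(δ)|/h_k(a)` for any finset `M ⊇` the members. -/
theorem abs_germ_symm_le_mass {a : Dir} (hpos : ∀ k, 0 < h28 a k) {T b : ℝ} (hb : b ∈ bkpts a T)
    {M : Finset (Fin 28)} (hM : ∀ k, (∃ z : ℤ, b * h28 a k = z) → k ∈ M) (δ : Fin 8 → ℝ)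
    {η : ℝ} (hη : 0 < η) (h1 : η * clusterBound a δ < 1) (h2 : η * clusterBound a δ < wallDist a T) :
    |germR a δ η b + germL a δ η b + germR a (-δ) η b + germL a (-δ) η b| ≤
      ∑ k ∈ M, |phiForm δ k| / h28 a k := by
  refine (abs_germ_symm_le_spread hpos hb hM δ hη h1 h2 0).trans (le_of_eq (Finset.sum_congr rfl fun k _ => ?_))
  rw [sub_zero, abs_div, abs_of_pos (hpos k)]

end Summit.KontsevichZagierPeriods.Zeta5Search.Barrier.ConeGamma

end
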